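import Mathlib
import Summits.RiemannHypothesis.RiemannHypothesis.Theorems.WeilFormatCOffDiagHSBound
import HarnessLib

/-!
# Format C, design C∞: far rows of a kernel under an envelope — row tails and the limit profile images

Route context: Fourier–Galerkin / Schur-complement certificates of Weil positivity on a window ("format C";
cell memo `run/shared/lean/pub/rh-explicit/rh-explicit-weil-10/KERNEL-LEVER.md` §18; supporting
stmt-RiemannHypothesis-0098; seat rh-explicit-weil-10).

The deflated certificate with limit data needs the finite-`P` profile images `Σ_{n∈[B,P)} M(n,m)V(n,j)` to approach their
limits `c∞(m,j)` at a rate summable against the far weights, uniformly usable for every truncation.  From a KERNEL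
ENVELOPE (`|M(n,m)| ≤ C₀/|n − m|` off the diagonal, `|M(n,n)| ≤ C₁ + C₂ log(1 + n)` on it — `WeilFormatCKernelEnvelope`
for Yoshida's matrix) and cube decay of the profile table (`|V(n,j)| ≤ K/n³`):

* `sum_Ico_inv_sq_le_two_div` — `Σ_{n∈[P,Q)} n⁻² ≤ 2/P`; `le_two_mul_abs_sub_mul` — `m ≤ 2|n − m|·n` (`n ≠ m`, `n ≥ 1`);
* `abs_mul_le_offDiag_row`, `abs_mul_le_diag_row` — the terms of a far row: `≤ 2C₀K/(mn²)` resp. `≤ 2(C₁+C₂)K/m²`;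
* `sum_Ico_abs_mul_le_row_tail` — ROW TAILS `Σ_{n∈[P,Q)} |M(n,m)V(n,j)| ≤ L/(mP)`, `L = (4C₀ + 2C₁ + 2C₂)K`;
* `abs_cinf_sub_le`, `abs_cinf_le`, `abs_sum_Ico_mul_le` — if `Σ_{n∈[B,P)} M(n,m)V(n,j) → c∞(m,j)` then
  `|c∞(m,j) − Σ_{n∈[B,P)} M(n,m)V(n,j)| ≤ L/(mP)`, `|c∞(m,j)| ≤ L/m`, `|Σ_{n∈[B,P)} M(n,m)V(n,j)| ≤ L/m`;
* `abs_block_row_le` — block rows decay: `|M(i,m)| ≤ C₀B/m` for `i < B ≤ m`.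

Sequel: `WeilFormatCDeflatedFarCoupling` (the coupling clause uniformly in `N`, and the limit wrapper with that clause
discharged).  Pure real analysis on sequences; standard axioms; nothing Weil-specific; no RH claim.
-/

-- `Summit.RiemannHypothesis.RiemannHypothesis.…` is the layout-mandated namespace (summit = problem name).
set_option linter.dupNamespace false

namespace Summit.RiemannHypothesis.RiemannHypothesis.Theorems.WeilFormatC

open Finset Filter Topology

/-! ## Elementary sums and envelope arithmetic -/

/-- `Σ_{n∈[P,Q)} 1/n² ≤ 2/P` for `P ≥ 1`. -/
theorem sum_Ico_inv_sq_le_two_div {P : ℕ} (hP : 1 ≤ P) (Q : ℕ) :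
    ∑ n ∈ Ico P Q, 1 / ((n : ℝ) ^ 2) ≤ 2 / (P : ℝ) := by
  have hsub : Ico P Q ⊆ insert P (Ioc P Q) := by
    intro n hn
    rw [Finset.mem_Ico] at hn
    rw [Finset.mem_insert, Finset.mem_Ioc]
    omega
  have hP' : (0 : ℝ) < P := by exact_mod_cast hP
  calc ∑ n ∈ Ico P Q, 1 / ((n : ℝ) ^ 2)
      ≤ ∑ n ∈ insert P (Ioc P Q), 1 / ((n : ℝ) ^ 2) :=
        Finset.sum_le_sum_of_subset_of_nonneg hsub fun n _ _ ↦ by positivity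
    _ = 1 / ((P : ℝ) ^ 2) + ∑ n ∈ Ioc P Q, 1 / ((n : ℝ) ^ 2) :=
        Finset.sum_insert (by simp)
    _ ≤ 1 / (P : ℝ) + 1 / (P : ℝ) := by
        refine add_le_add ?_ (sum_Ioc_inv_sq_le hP)
        rw [div_le_div_iff₀ (by positivity) hP']
        have : (1 : ℝ) ≤ P := by exact_mod_cast hP
        nlinarith
    _ = 2 / (P : ℝ) := by ring

/-- For `n ≠ m`, `n, m ≥ 1`: `m ≤ 2|n − m|·n`, i.e. `1/(|n − m|·n) ≤ 2/m`. -/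
theorem le_two_mul_abs_sub_mul {n m : ℕ} (hn : 1 ≤ n) (hnm : n ≠ m) :
    (m : ℝ) ≤ 2 * |(n : ℝ) - m| * n := by
  have hn' : (1 : ℝ) ≤ n := by exact_mod_cast hn
  rcases lt_or_gt_of_ne hnm with h | h
  · have h' : (n : ℝ) + 1 ≤ m := by exact_mod_cast h
    rw [abs_of_neg (by linarith), neg_sub]
    nlinarith
  · have h' : (m : ℝ) + 1 ≤ n := by exact_mod_cast h
    rw [abs_of_pos (by linarith)]
    have hm0 : (0 : ℝ) ≤ m := Nat.cast_nonneg m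
    nlinarith

/-- **Off-diagonal term of a far row**: `|M(n,m)| ≤ C₀/|n − m|` and `|v| ≤ K/n³` give `|M(n,m)·v| ≤ 2C₀K/(m·n²)`
(`n ≠ m`, `n, m ≥ 1`). -/
theorem abs_mul_le_offDiag_row {M : ℕ → ℕ → ℝ} {C₀ K : ℝ} (hC₀ : 0 ≤ C₀) (hK : 0 ≤ K)
    (hoff : ∀ n m, n ≠ m → |M n m| ≤ C₀ / |(n : ℝ) - m|)
    {n m : ℕ} (hn : 1 ≤ n) (hm : 1 ≤ m) (hnm : n ≠ m) {v : ℝ} (hv : |v| ≤ K / (n : ℝ) ^ 3) :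
    |M n m * v| ≤ 2 * C₀ * K / ((m : ℝ) * (n : ℝ) ^ 2) := by
  have hn' : (0 : ℝ) < n := by exact_mod_cast hn
  have hm' : (0 : ℝ) < m := by exact_mod_cast hm
  have hgap : 0 < |(n : ℝ) - m| := by
    rw [abs_pos, sub_ne_zero]; exact_mod_cast hnm
  have hkey := le_two_mul_abs_sub_mul hn hnm (m := m)
  rw [abs_mul]
  calc |M n m| * |v| ≤ C₀ / |(n : ℝ) - m| * (K / (n : ℝ) ^ 3) :=
        mul_le_mul (hoff n m hnm) hv (abs_nonneg _) (by positivity)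
    _ = C₀ * K / (|(n : ℝ) - m| * n) / (n : ℝ) ^ 2 := by
        field_simp
    _ ≤ C₀ * K / ((m : ℝ) / 2) / (n : ℝ) ^ 2 :=
        div_le_div_of_nonneg_right
          (div_le_div_of_nonneg_left (mul_nonneg hC₀ hK) (by positivity) (by linarith)) (by positivity)
    _ = 2 * C₀ * K / ((m : ℝ) * (n : ℝ) ^ 2) := by
        field_simp

/-- **Diagonal term of a far row**: `|M(m,m)| ≤ C₁ + C₂ log(1 + m)` and `|v| ≤ K/m³` give `|M(m,m)·v| ≤ 2(C₁ + C₂)K/m²`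
(`m ≥ 1`; `log(1 + m) ≤ m`). -/
theorem abs_mul_le_diag_row {M : ℕ → ℕ → ℝ} {C₁ C₂ K : ℝ} (hC₁ : 0 ≤ C₁) (hC₂ : 0 ≤ C₂)
    (hdiag : ∀ n, |M n n| ≤ C₁ + C₂ * Real.log (1 + n))
    {m : ℕ} (hm : 1 ≤ m) {v : ℝ} (hv : |v| ≤ K / (m : ℝ) ^ 3) :
    |M m m * v| ≤ 2 * (C₁ + C₂) * K / (m : ℝ) ^ 2 := by
  have hm' : (1 : ℝ) ≤ m := by exact_mod_cast hm
  have hm0 : (0 : ℝ) < m := by linarith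
  have hlog : Real.log (1 + m) ≤ m := by
    have := Real.add_one_le_exp (m : ℝ)
    calc Real.log (1 + m) ≤ Real.log (Real.exp m) := Real.log_le_log (by linarith) (by linarith)
      _ = m := Real.log_exp _
  have hM : |M m m| ≤ (C₁ + C₂) * (2 * m) := by
    have h := hdiag m
    nlinarith
  rw [abs_mul]
  calc |M m m| * |v| ≤ (C₁ + C₂) * (2 * m) * (K / (m : ℝ) ^ 3) :=
        mul_le_mul hM hv (abs_nonneg _) (by positivity)
    _ = 2 * (C₁ + C₂) * K / (m : ℝ) ^ 2 := by
        field_simp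

/-- **Row tails under the envelope.**  For `1 ≤ P`, any `Q`, `m ≥ 1`:
`Σ_{n∈[P,Q)} |M(n,m)·V(n,j)| ≤ L/(m·P)` with `L = (4C₀ + 2C₁ + 2C₂)K` (off-diagonal terms `≤ 2C₀K/(mn²)` summed by
`Σ_{n≥P} n⁻² ≤ 2/P`; the diagonal term, present only if `P ≤ m`, is `≤ 2(C₁+C₂)K/m² ≤ 2(C₁+C₂)K/(mP)`). -/
theorem sum_Ico_abs_mul_le_row_tail {M : ℕ → ℕ → ℝ} {r : ℕ} {V : ℕ → Fin r → ℝ} {C₀ C₁ C₂ K : ℝ}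
    (hC₀ : 0 ≤ C₀) (hC₁ : 0 ≤ C₁) (hC₂ : 0 ≤ C₂) (hK : 0 ≤ K)
    (hoff : ∀ n m, n ≠ m → |M n m| ≤ C₀ / |(n : ℝ) - m|)
    (hdiag : ∀ n, |M n n| ≤ C₁ + C₂ * Real.log (1 + n))
    {P : ℕ} (hP : 1 ≤ P) (hV : ∀ n j, P ≤ n → |V n j| ≤ K / (n : ℝ) ^ 3)
    (Q : ℕ) {m : ℕ} (hm : 1 ≤ m) (j : Fin r) :
    ∑ n ∈ Ico P Q, |M n m * V n j| ≤ (4 * C₀ + 2 * C₁ + 2 * C₂) * K / ((m : ℝ) * P) := by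
  have hm0 : (0 : ℝ) < m := by exact_mod_cast hm
  have hP0 : (0 : ℝ) < P := by exact_mod_cast hP
  -- termwise majorant: off-diagonal part + diagonal indicator
  have hterm : ∀ n ∈ Ico P Q, |M n m * V n j|
      ≤ 2 * C₀ * K / (m : ℝ) * (1 / (n : ℝ) ^ 2) + (if n = m then 2 * (C₁ + C₂) * K / (m : ℝ) ^ 2 else 0) := by
    intro n hn
    have hPn : P ≤ n := (Finset.mem_Ico.1 hn).1
    have hn1 : 1 ≤ n := hP.trans hPn
    have hvn := hV n j hPn
    by_cases hnm : n = m
    · subst hnm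
      rw [if_pos rfl]
      have h1 := abs_mul_le_diag_row hC₁ hC₂ hdiag hn1 hvn
      have h2 : 0 ≤ 2 * C₀ * K / (n : ℝ) * (1 / (n : ℝ) ^ 2) := by positivity
      linarith
    · rw [if_neg hnm, add_zero]
      have h1 := abs_mul_le_offDiag_row hC₀ hK hoff hn1 hm hnm hvn
      calc |M n m * V n j| ≤ 2 * C₀ * K / ((m : ℝ) * (n : ℝ) ^ 2) := h1
        _ = 2 * C₀ * K / (m : ℝ) * (1 / (n : ℝ) ^ 2) := by
            have hn0 : (0 : ℝ) < n := by exact_mod_cast hn1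
            field_simp
  refine (Finset.sum_le_sum hterm).trans ?_
  rw [Finset.sum_add_distrib, ← Finset.mul_sum, Finset.sum_ite_eq']
  have h1 : 2 * C₀ * K / (m : ℝ) * ∑ n ∈ Ico P Q, 1 / (n : ℝ) ^ 2 ≤ 2 * C₀ * K / (m : ℝ) * (2 / P) :=
    mul_le_mul_of_nonneg_left (sum_Ico_inv_sq_le_two_div hP Q) (by positivity)
  have h2 : (if m ∈ Ico P Q then 2 * (C₁ + C₂) * K / (m : ℝ) ^ 2 else 0) ≤ 2 * (C₁ + C₂) * K / ((m : ℝ) * P) := by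
    split_ifs with hmem
    · have hPm : (P : ℝ) ≤ m := by exact_mod_cast (Finset.mem_Ico.1 hmem).1
      rw [div_le_div_iff₀ (by positivity) (by positivity)]
      have : 0 ≤ 2 * (C₁ + C₂) * K := by positivity
      nlinarith [mul_le_mul_of_nonneg_left hPm hm0.le]
    · positivity
  calc 2 * C₀ * K / (m : ℝ) * ∑ n ∈ Ico P Q, 1 / (n : ℝ) ^ 2
        + (if m ∈ Ico P Q then 2 * (C₁ + C₂) * K / (m : ℝ) ^ 2 else 0)
      ≤ 2 * C₀ * K / (m : ℝ) * (2 / P) + 2 * (C₁ + C₂) * K / ((m : ℝ) * P) := add_le_add h1 h2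
    _ = (4 * C₀ + 2 * C₁ + 2 * C₂) * K / ((m : ℝ) * P) := by
        field_simp
        ring

/-- The finite profile images are bounded by the row sums:
`|Σ_{n∈[P,Q)} M(n,m)V(n,j)| ≤ L/(mP)`. -/
theorem abs_sum_Ico_mul_le_row_tail {M : ℕ → ℕ → ℝ} {r : ℕ} {V : ℕ → Fin r → ℝ} {C₀ C₁ C₂ K : ℝ}
    (hC₀ : 0 ≤ C₀) (hC₁ : 0 ≤ C₁) (hC₂ : 0 ≤ C₂) (hK : 0 ≤ K)
    (hoff : ∀ n m, n ≠ m → |M n m| ≤ C₀ / |(n : ℝ) - m|)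
    (hdiag : ∀ n, |M n n| ≤ C₁ + C₂ * Real.log (1 + n))
    {P : ℕ} (hP : 1 ≤ P) (hV : ∀ n j, P ≤ n → |V n j| ≤ K / (n : ℝ) ^ 3)
    (Q : ℕ) {m : ℕ} (hm : 1 ≤ m) (j : Fin r) :
    |∑ n ∈ Ico P Q, M n m * V n j| ≤ (4 * C₀ + 2 * C₁ + 2 * C₂) * K / ((m : ℝ) * P) :=
  (Finset.abs_sum_le_sum_abs _ _).trans (sum_Ico_abs_mul_le_row_tail hC₀ hC₁ hC₂ hK hoff hdiag hP hV Q hm j)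

/-! ## The limit profile images -/

section Limit

variable {M : ℕ → ℕ → ℝ} {B r : ℕ} {V : ℕ → Fin r → ℝ} {C₀ C₁ C₂ K : ℝ} {cinf : ℕ → Fin r → ℝ}

/-- **Tail of the limit image**: if `Σ_{n∈[B,P)} M(n,m)V(n,j) → c∞(m,j)` then for `P ≥ B ≥ 1`, `m ≥ 1`:
`|c∞(m,j) − Σ_{n∈[B,P)} M(n,m)V(n,j)| ≤ L/(mP)`. -/
theorem abs_cinf_sub_le (hC₀ : 0 ≤ C₀) (hC₁ : 0 ≤ C₁) (hC₂ : 0 ≤ C₂) (hK : 0 ≤ K) (hB : 1 ≤ B)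
    (hoff : ∀ n m, n ≠ m → |M n m| ≤ C₀ / |(n : ℝ) - m|)
    (hdiag : ∀ n, |M n n| ≤ C₁ + C₂ * Real.log (1 + n))
    (hV : ∀ n j, B ≤ n → |V n j| ≤ K / (n : ℝ) ^ 3)
    {m : ℕ} (hm : 1 ≤ m) {j : Fin r}
    (hc : Tendsto (fun P ↦ ∑ n ∈ Ico B P, M n m * V n j) atTop (𝓝 (cinf m j)))
    {P : ℕ} (hBP : B ≤ P) :
    |cinf m j - ∑ n ∈ Ico B P, M n m * V n j| ≤ (4 * C₀ + 2 * C₁ + 2 * C₂) * K / ((m : ℝ) * P) := by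
  have hP : 1 ≤ P := hB.trans hBP
  have hV' : ∀ n j, P ≤ n → |V n j| ≤ K / (n : ℝ) ^ 3 := fun n j hn ↦ hV n j (hBP.trans hn)
  -- the differences `c^Q − c^P` are row tails over `[P, Q)`
  have hQ : ∀ᶠ Q in atTop, |(∑ n ∈ Ico B Q, M n m * V n j) - ∑ n ∈ Ico B P, M n m * V n j|
      ≤ (4 * C₀ + 2 * C₁ + 2 * C₂) * K / ((m : ℝ) * P) := by
    filter_upwards [eventually_ge_atTop P] with Q hPQ
    rw [← Finset.sum_Ico_consecutive _ hBP hPQ, add_sub_cancel_left]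
    exact abs_sum_Ico_mul_le_row_tail hC₀ hC₁ hC₂ hK hoff hdiag hP hV' Q hm j
  have hlim : Tendsto (fun Q ↦ |(∑ n ∈ Ico B Q, M n m * V n j) - ∑ n ∈ Ico B P, M n m * V n j|) atTop
      (𝓝 |cinf m j - ∑ n ∈ Ico B P, M n m * V n j|) :=
    (hc.sub_const _).abs
  exact le_of_tendsto hlim hQ

/-- **Size of the limit image**: `|c∞(m,j)| ≤ L/m` (`B ≥ 1`, `m ≥ 1`). -/
theorem abs_cinf_le (hC₀ : 0 ≤ C₀) (hC₁ : 0 ≤ C₁) (hC₂ : 0 ≤ C₂) (hK : 0 ≤ K) (hB : 1 ≤ B)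
    (hoff : ∀ n m, n ≠ m → |M n m| ≤ C₀ / |(n : ℝ) - m|)
    (hdiag : ∀ n, |M n n| ≤ C₁ + C₂ * Real.log (1 + n))
    (hV : ∀ n j, B ≤ n → |V n j| ≤ K / (n : ℝ) ^ 3)
    {m : ℕ} (hm : 1 ≤ m) {j : Fin r}
    (hc : Tendsto (fun P ↦ ∑ n ∈ Ico B P, M n m * V n j) atTop (𝓝 (cinf m j))) :
    |cinf m j| ≤ (4 * C₀ + 2 * C₁ + 2 * C₂) * K / (m : ℝ) := by
  have hm0 : (0 : ℝ) < m := by exact_mod_cast hm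
  have hB0 : (1 : ℝ) ≤ B := by exact_mod_cast hB
  have hL : 0 ≤ (4 * C₀ + 2 * C₁ + 2 * C₂) * K := by positivity
  have hQ : ∀ Q, |∑ n ∈ Ico B Q, M n m * V n j| ≤ (4 * C₀ + 2 * C₁ + 2 * C₂) * K / (m : ℝ) := fun Q ↦
    (abs_sum_Ico_mul_le_row_tail hC₀ hC₁ hC₂ hK hoff hdiag hB hV Q hm j).trans (by
      rw [div_le_div_iff₀ (by positivity) hm0]
      nlinarith [mul_nonneg hL hm0.le])
  exact le_of_tendsto hc.abs (Eventually.of_forall hQ)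

/-- The finite profile images are bounded: `|Σ_{n∈[B,P)} M(n,m)V(n,j)| ≤ L/m` (`B ≥ 1`, `m ≥ 1`). -/
theorem abs_sum_Ico_mul_le (hC₀ : 0 ≤ C₀) (hC₁ : 0 ≤ C₁) (hC₂ : 0 ≤ C₂) (hK : 0 ≤ K) (hB : 1 ≤ B)
    (hoff : ∀ n m, n ≠ m → |M n m| ≤ C₀ / |(n : ℝ) - m|)
    (hdiag : ∀ n, |M n n| ≤ C₁ + C₂ * Real.log (1 + n))
    (hV : ∀ n j, B ≤ n → |V n j| ≤ K / (n : ℝ) ^ 3)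
    {m : ℕ} (hm : 1 ≤ m) (j : Fin r) (P : ℕ) :
    |∑ n ∈ Ico B P, M n m * V n j| ≤ (4 * C₀ + 2 * C₁ + 2 * C₂) * K / (m : ℝ) := by
  have hm0 : (0 : ℝ) < m := by exact_mod_cast hm
  have hB0 : (1 : ℝ) ≤ B := by exact_mod_cast hB
  have hL : 0 ≤ (4 * C₀ + 2 * C₁ + 2 * C₂) * K := by positivity
  refine (abs_sum_Ico_mul_le_row_tail hC₀ hC₁ hC₂ hK hoff hdiag hB hV P hm j).trans ?_
  rw [div_le_div_iff₀ (by positivity) hm0]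
  nlinarith [mul_nonneg hL hm0.le]

/-- **Block rows decay**: for `i < B ≤ m`, `|M(i,m)| ≤ C₀/(m − i) ≤ C₀B/m`. -/
theorem abs_block_row_le (hC₀ : 0 ≤ C₀) (hoff : ∀ n m, n ≠ m → |M n m| ≤ C₀ / |(n : ℝ) - m|)
    {i m : ℕ} (hi : i < B) (hm : B ≤ m) :
    |M i m| ≤ C₀ * B / (m : ℝ) := by
  have him : i < m := lt_of_lt_of_le hi hm
  have hm0 : (0 : ℝ) < m := by exact_mod_cast (lt_of_le_of_lt (Nat.zero_le i) him)
  have h := hoff i m (Nat.ne_of_lt him)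
  have hgap : |(i : ℝ) - m| = (m : ℝ) - i := by
    rw [abs_sub_comm, abs_of_pos]
    have : (i : ℝ) < m := by exact_mod_cast him
    linarith
  rw [hgap] at h
  refine h.trans ?_
  have hmi : (0 : ℝ) < (m : ℝ) - i := by
    have : (i : ℝ) < m := by exact_mod_cast him
    linarith
  rw [div_le_div_iff₀ hmi hm0]
  -- `m ≤ B(m − i)` since `i ≤ B − 1` and `m ≥ B`
  have h1 : (i : ℝ) + 1 ≤ B := by exact_mod_cast hi
  have h2 : (B : ℝ) ≤ m := by exact_mod_cast hm
  nlinarith [mul_nonneg hC₀ (sub_nonneg.2 h2), mul_nonneg hC₀ (sub_nonneg.2 h1)]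

end Limit

end Summit.RiemannHypothesis.RiemannHypothesis.Theorems.WeilFormatC
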